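import Summits.QuantumFields.YangMills.Theorems.FluctuationComparisonRegPrIntLS2BetaLaplacePeano
import Literature.Analysis.Asymptotics.LaplaceMethodCompactGroupSmooth
import HarnessLib

/-!
# S2β · POS∘ — THE TAYLOR HALF (T1): «HESS∘ ⟹ QUADRATIC GROWTH» — the second-order sufficient condition, read into the tree's growth row `hgrow`

Cell `ym3-torus` (YM ladder rung R3 = continuum `SU(2)` Yang–Mills on the three-torus at fixed lattice data — a RUNG: NOT d = 4, NOT infinite volume,
NOT a mass gap, NOT Clay).  Width seat `ym3-torus-px21` (gen 18); pen «the Taylor half: Hess > 0 on the tube frame at `y = 0` ⟹ POS∘ collar» named by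
px8 g18 (STATUS 22:20:29Z) after ✓`…S2BetaTubeGrowthOfIsolated` (TUBE♭ ⟸ {POS∘, ISOL∘(δ)}), cut (T1)∕(T2) at the tree's growth interface; ★★OWNER g40 WORD №225 (B).
Crux `stmt-QuantumFields-20520` (`…Theses.UnitScaleTilt.FluctuationComparisonRegPrIntL`), LINE g18-1 S2β; `--kind proof --supports stmt-QuantumFields-20520 --as helper`,
count-neutral, DEFINITION-FREE (0 `def`, 0 `instance`, 0 `notation`, 0 `sorry`, default heartbeats).

WHY.  The tree reads the per-datum quadratic growth of the action along the tubular transversal `σ` through a base point in ONE currency: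
`hgrow : ∃ c > 0, ∀ᶠ y in 𝓝 0, c·‖y‖² ≤ φ y − φ 0` (`φ := A ∘ Φ_V ∘ σ`) — it is the INPUT row of ✓`…S2BetaLaplacePeano.hessianRows_of_contDiffAt_of_growth`
(growth ⟹ the LIMIT door's Hessian rows), the PEANO growth row of the v8 `ChartPackage` (✓`…S2BetaChartPackageGrowthRow`, there derived FROM GAP♯), and — through the
chart bridge (T2) — the collar letter POS∘ of ✓`tubeGrowth_of_pos_of_isolated`.  Print's (142) [Balaban1985Variational] p.299 («the second order differential … is a
positive definite form») is a statement about the HESSIAN at the minimiser.  THIS FILE is the converse of ✓LaplacePeano, i.e. the classical second-order SUFFICIENT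
condition for a strict local minimum with its quadratic modulus, in the tree's letters: on a finite-dimensional real inner-product space,
`C²` at the point + critical point (or local minimum) + `D²φ(x₀) y y > 0` for `y ≠ 0` ⟹ `∃ c > 0, c‖x − x₀‖² ≤ φ x − φ x₀` near `x₀`.
Proof = the tree's Peano expansion ✓`Literature.Analysis.Asymptotics.isLittleO_taylor_two` (via ✓`peano_two_of_contDiffAt_of_isLocalMin` ∕
✓`hasFDerivAt_data_of_contDiffAt_two`) + the coercive constant of a positive-definite symmetric operator ✓`exists_pos_mul_norm_sq_le_inner` (least eigenvalue)
with `ε := c∕4` in the little-o.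

WHAT.
* §1 ★ `quadratic_growth_of_peano` — symmetric positive-definite `A` + Peano `S x − S x₀ − ½⟪A(x−x₀), x−x₀⟫ = o(‖x−x₀‖²)` ⟹ `∃ c > 0, ∀ᶠ x, c‖x−x₀‖² ≤ S x − S x₀`
  (the inline step of ✓`tendsto_laplaceMethod` ∕ ✓`tendsto_laplaceMethod_chart`, exported).
* §2 ★★ `quadratic_growth_of_contDiffAt_of_fderiv_eq_zero` — `ContDiffAt ℝ 2 F x₀`, `fderiv ℝ F x₀ = 0`, `∀ y ≠ 0, 0 < D²F(x₀) y y` ⟹ growth (HESS∘ in `fderiv` letters);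
  ★★ `quadratic_growth_of_contDiffAt_of_isLocalMin_of_line` — the same with `IsLocalMin F x₀` and HESS∘ as positive SECOND VARIATIONS ALONG LINES
  `0 < d²∕dt²|₀ F(x₀ + t y)` (the form ✓`iteratedDeriv_two_along_line` ∕ `wilsonPlaquetteSumAlong` computations produce); `isLocalMin_of_quadratic_growth` (growth ⟹ strict∕local min).
* §3 ★★★ `growthRow_of_hessian_pos` ∕ `growthRow_of_line_pos` — AT `x₀ = 0`: the `hgrow` row of ✓`hessianRows_of_contDiffAt_of_growth` VERBATIM
  (`∃ c, 0 < c ∧ ∀ᶠ y in 𝓝 0, c * ‖y‖ ^ 2 ≤ φ y − φ 0`); ★★★ `growthRow_iff_isLocalMin_and_hessian_pos` — for `φ` `C²` at `0`: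
  growth row ⟺ (`IsLocalMin φ 0` ∧ HESS∘), the two-way door between print's (142) and the tree's growth currency; `hessianRows_of_hessian_pos` — HESS∘ ⟹ the LIMIT door's
  three Hessian rows directly (✓LaplacePeano ∘ §3).

HONEST: finite-dimensional calculus; HESS∘ itself (positivity of the constrained Hessian of the Wilson action modulo the residual gauge at print's regular minimiser —
[Balaban1985Variational] (142), [Balaban1985BackgroundPropagators] Thm 3.11) is NOT proved here and stays a DISPLAYED hypothesis of its consumers; POS∘, ISOL∘(δ), TUBE-REG∘,
GAP♯∘, GAP♭, EXW∘, S2β, crux 20520 NOT proved; no summit statement is proved by a helper; rung R3 = SU(2) YM₃ on T³ — NOT d = 4, NOT infinite volume, NOT a mass gap,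
NOT Clay; the Yang–Mills mass gap is NOT proved.  Sorry-free, axioms standard.

References: T. Bałaban, CMP **102** (1985) 277–309 [Balaban1985Variational] ((142) p.299); K. W. Breitung, LNM 1592 (1994) [Breitung1994] (Thm 41 p.56, Lemma 40 p.55).
-/

set_option autoImplicit false

noncomputable section

namespace Summit.QuantumFields.YangMills.Theorems.FluctuationComparisonRegPrIntLS2BetaGrowthOfHessianPos

open Filter Topology Asymptotics
open scoped InnerProductSpace
open Literature.Analysis.Asymptotics
open Summit.QuantumFields.YangMills.Theorems.FluctuationComparisonRegPrIntLS2BetaLaplacePeano (hessianRows_of_contDiffAt_of_growth)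

variable {V : Type*} [NormedAddCommGroup V] [InnerProductSpace ℝ V] [FiniteDimensional ℝ V]

/-! ## §1 Growth from a Peano expansion with positive-definite symmetric quadratic part -/

/-- ★ **QUADRATIC GROWTH FROM THE PEANO EXPANSION.**  `A` symmetric with `⟪A y, y⟫ > 0` (`y ≠ 0`) on a finite-dimensional space, and
`S x − S x₀ − ½⟪A(x − x₀), x − x₀⟫ = o(‖x − x₀‖²)` at `x₀` ⟹ `∃ c > 0`, `c‖x − x₀‖² ≤ S x − S x₀` for `x` near `x₀` (`c` = a quarter of the least eigenvalue of `A`).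
[cite: Breitung1994, Thm 41 p.56 and Lemma 40 (5.22) p.55] -/
theorem quadratic_growth_of_peano {S : V → ℝ} {x₀ : V} {A : V →ₗ[ℝ] V} (hA : A.IsSymmetric) (hpos : ∀ y, y ≠ 0 → 0 < ⟪A y, y⟫_ℝ)
    (hS2 : (fun x => S x - S x₀ - (1 / 2) * ⟪A (x - x₀), x - x₀⟫_ℝ) =o[𝓝 x₀] fun x => ‖x - x₀‖ ^ 2) :
    ∃ c : ℝ, 0 < c ∧ ∀ᶠ x in 𝓝 x₀, c * ‖x - x₀‖ ^ 2 ≤ S x - S x₀ := by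
  obtain ⟨c, hc, hcoer⟩ := exists_pos_mul_norm_sq_le_inner hA hpos
  have hc4 : 0 < c / 4 := by positivity
  refine ⟨c / 4, hc4, ?_⟩
  filter_upwards [hS2.def hc4] with x hx
  rw [Real.norm_eq_abs, Real.norm_eq_abs, abs_of_nonneg (by positivity : (0 : ℝ) ≤ ‖x - x₀‖ ^ 2)] at hx
  have h2 := hcoer (x - x₀)
  have h3 := neg_abs_le (S x - S x₀ - (1 / 2) * ⟪A (x - x₀), x - x₀⟫_ℝ)
  nlinarith

omit [InnerProductSpace ℝ V] [FiniteDimensional ℝ V] in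
/-- Quadratic growth near `x₀` makes `x₀` a local minimum. [cite: Breitung1994, Thm 41 p.56] -/
theorem isLocalMin_of_quadratic_growth {S : V → ℝ} {x₀ : V} {c : ℝ} (hc : 0 < c)
    (hgrow : ∀ᶠ x in 𝓝 x₀, c * ‖x - x₀‖ ^ 2 ≤ S x - S x₀) : IsLocalMin S x₀ := by
  filter_upwards [hgrow] with x hx
  nlinarith [sq_nonneg ‖x - x₀‖, hc.le]

omit [InnerProductSpace ℝ V] [FiniteDimensional ℝ V] in
/-- Quadratic growth near `x₀` makes `x₀` a STRICT local minimum: `S x₀ < S x` for `x ≠ x₀` near `x₀`. [cite: Breitung1994, Thm 41 p.56] -/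
theorem eventually_lt_of_quadratic_growth {S : V → ℝ} {x₀ : V} {c : ℝ} (hc : 0 < c)
    (hgrow : ∀ᶠ x in 𝓝 x₀, c * ‖x - x₀‖ ^ 2 ≤ S x - S x₀) : ∀ᶠ x in 𝓝 x₀, x ≠ x₀ → S x₀ < S x := by
  filter_upwards [hgrow] with x hx hne
  have hn : 0 < ‖x - x₀‖ := norm_pos_iff.2 (sub_ne_zero.2 hne)
  nlinarith [mul_pos hc (pow_pos hn 2)]

/-! ## §2 HESS∘ ⟹ growth: the second-order sufficient condition -/

/-- ★★ **SECOND-ORDER SUFFICIENT CONDITION, `fderiv` LETTERS.**  `F` `C²` at `x₀`, `fderiv ℝ F x₀ = 0`, and the Hessian `D²F(x₀) = fderiv (fderiv F) x₀` positive: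
`0 < D²F(x₀) y y` for `y ≠ 0` ⟹ `∃ c > 0`, `c‖x − x₀‖² ≤ F x − F x₀` near `x₀`.  (Peano ✓`isLittleO_taylor_two` for the Riesz representative of the Hessian, symmetric by
✓`second_derivative_symmetric_of_eventually_of_real`, then §1.) [cite: Breitung1994, Thm 41 p.56; Balaban1985Variational, (142) p.299] -/
theorem quadratic_growth_of_contDiffAt_of_fderiv_eq_zero {F : V → ℝ} {x₀ : V} (hF : ContDiffAt ℝ 2 F x₀) (hcrit : fderiv ℝ F x₀ = 0)
    (hH : ∀ y, y ≠ 0 → 0 < fderiv ℝ (fderiv ℝ F) x₀ y y) :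
    ∃ c : ℝ, 0 < c ∧ ∀ᶠ x in 𝓝 x₀, c * ‖x - x₀‖ ^ 2 ≤ F x - F x₀ := by
  obtain ⟨hS1, hS2⟩ := hasFDerivAt_data_of_contDiffAt_two hF
  set S'' : V →L[ℝ] V →L[ℝ] ℝ := fderiv ℝ (fderiv ℝ F) x₀ with hS''
  set A : V →ₗ[ℝ] V :=
    ((InnerProductSpace.continuousLinearMapOfBilin (𝕜 := ℝ) S'' : V →L[ℝ] V) : V →ₗ[ℝ] V) with hAdef
  have hsymm : ∀ v w, S'' v w = S'' w v := second_derivative_symmetric_of_eventually_of_real hS1 hS2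
  have hAS' : ∀ y z, ⟪A y, z⟫_ℝ = S'' y z := fun y z => by
    rw [hAdef, ContinuousLinearMap.coe_coe, InnerProductSpace.continuousLinearMapOfBilin_apply]
  have hA : A.IsSymmetric := fun y z => by
    rw [hAS', hsymm, ← hAS', real_inner_comm]
  have hApos : ∀ y, y ≠ 0 → 0 < ⟪A y, y⟫_ℝ := fun y hy => by
    rw [hAS']
    exact hH y hy
  have hPeano : (fun x => F x - F x₀ - (1 / 2) * ⟪A (x - x₀), x - x₀⟫_ℝ) =o[𝓝 x₀] fun x => ‖x - x₀‖ ^ 2 := by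
    refine (isLittleO_taylor_two hS1 hS2).congr' (Eventually.of_forall fun x => ?_) EventuallyEq.rfl
    simp only [hcrit, zero_apply, sub_zero, hAS']
  exact quadratic_growth_of_peano hA hApos hPeano

/-- ★★ **SECOND-ORDER SUFFICIENT CONDITION AT A LOCAL MINIMUM, `fderiv` LETTERS** (the critical-point hypothesis discharged by `IsLocalMin.fderiv_eq_zero`).
[cite: Breitung1994, Thm 41 p.56; Balaban1985Variational, (142) p.299] -/
theorem quadratic_growth_of_contDiffAt_of_isLocalMin {F : V → ℝ} {x₀ : V} (hF : ContDiffAt ℝ 2 F x₀) (hmin : IsLocalMin F x₀)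
    (hH : ∀ y, y ≠ 0 → 0 < fderiv ℝ (fderiv ℝ F) x₀ y y) :
    ∃ c : ℝ, 0 < c ∧ ∀ᶠ x in 𝓝 x₀, c * ‖x - x₀‖ ^ 2 ≤ F x - F x₀ :=
  quadratic_growth_of_contDiffAt_of_fderiv_eq_zero hF hmin.fderiv_eq_zero hH

/-- ★★ **SECOND-ORDER SUFFICIENT CONDITION, LINE LETTERS.**  `F` `C²` at a local minimum `x₀` with POSITIVE SECOND VARIATION ALONG EVERY LINE,
`0 < d²∕dt²|₀ F(x₀ + t y)` (`y ≠ 0`) ⟹ `∃ c > 0`, `c‖x − x₀‖² ≤ F x − F x₀` near `x₀` (✓`peano_two_of_contDiffAt_of_isLocalMin` then §1).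
[cite: Breitung1994, Thm 41 p.56 and Lemma 7 p.12; Balaban1985Variational, (142) p.299] -/
theorem quadratic_growth_of_contDiffAt_of_isLocalMin_of_line {F : V → ℝ} {x₀ : V} (hF : ContDiffAt ℝ 2 F x₀) (hmin : IsLocalMin F x₀)
    (hline : ∀ y, y ≠ 0 → 0 < iteratedDeriv 2 (fun t : ℝ => F (x₀ + t • y)) 0) :
    ∃ c : ℝ, 0 < c ∧ ∀ᶠ x in 𝓝 x₀, c * ‖x - x₀‖ ^ 2 ≤ F x - F x₀ := by
  obtain ⟨A, hA, -, hpos, hS2⟩ := peano_two_of_contDiffAt_of_isLocalMin hF hmin hline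
  exact quadratic_growth_of_peano hA hpos hS2

omit [FiniteDimensional ℝ V] in
/-- The two HESS∘ letters agree for a `C²` point: `d²∕dt²|₀ F(x₀ + t y) = D²F(x₀) y y` (✓`iteratedDeriv_two_along_line`). [cite: Breitung1994, Lemma 7 p.12] -/
theorem iteratedDeriv_two_line_eq_fderiv_fderiv {F : V → ℝ} {x₀ : V} (hF : ContDiffAt ℝ 2 F x₀) (y : V) :
    iteratedDeriv 2 (fun t : ℝ => F (x₀ + t • y)) 0 = fderiv ℝ (fderiv ℝ F) x₀ y y := by
  obtain ⟨hS1, hS2⟩ := hasFDerivAt_data_of_contDiffAt_two hF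
  exact iteratedDeriv_two_along_line hS1 hS2 y

/-! ## §3 At `x₀ = 0`: the tree's growth row `hgrow` and the two-way door -/

/-- ★★★ **THE GROWTH ROW FROM HESS∘** (at the origin of the transversal window): `φ` `C²` at `0`, `0` a local minimum, `0 < D²φ(0) y y` for `y ≠ 0` ⟹
`∃ c, 0 < c ∧ ∀ᶠ y in 𝓝 0, c * ‖y‖ ^ 2 ≤ φ y − φ 0` — the `hgrow` row of ✓`…S2BetaLaplacePeano.hessianRows_of_contDiffAt_of_growth` ∕ the PEANO growth row of the v8
`ChartPackage` VERBATIM (read `φ := fun y => wilsonAction4 (c.Φ (V, σ y))`). [cite: Balaban1985Variational, (142) p.299; Breitung1994, Thm 41 p.56] -/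
theorem growthRow_of_hessian_pos {φ : V → ℝ} (hφ : ContDiffAt ℝ 2 φ 0) (hmin : IsLocalMin φ 0)
    (hH : ∀ y, y ≠ 0 → 0 < fderiv ℝ (fderiv ℝ φ) 0 y y) :
    ∃ c : ℝ, 0 < c ∧ ∀ᶠ y in 𝓝 (0 : V), c * ‖y‖ ^ 2 ≤ φ y - φ 0 := by
  simpa only [sub_zero] using quadratic_growth_of_contDiffAt_of_isLocalMin hφ hmin hH

/-- ★★★ **THE GROWTH ROW FROM HESS∘, CRITICAL-POINT FORM** (no minimality assumed: `fderiv ℝ φ 0 = 0`). [cite: Balaban1985Variational, (142) p.299; Breitung1994, Thm 41 p.56] -/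
theorem growthRow_of_hessian_pos_of_fderiv_eq_zero {φ : V → ℝ} (hφ : ContDiffAt ℝ 2 φ 0) (hcrit : fderiv ℝ φ 0 = 0)
    (hH : ∀ y, y ≠ 0 → 0 < fderiv ℝ (fderiv ℝ φ) 0 y y) :
    ∃ c : ℝ, 0 < c ∧ ∀ᶠ y in 𝓝 (0 : V), c * ‖y‖ ^ 2 ≤ φ y - φ 0 := by
  simpa only [sub_zero] using quadratic_growth_of_contDiffAt_of_fderiv_eq_zero hφ hcrit hH

/-- ★★★ **THE GROWTH ROW FROM HESS∘, LINE FORM** (`0 < d²∕dt²|₀ φ(t y)` for `y ≠ 0`). [cite: Balaban1985Variational, (142) p.299; Breitung1994, Thm 41 p.56] -/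
theorem growthRow_of_line_pos {φ : V → ℝ} (hφ : ContDiffAt ℝ 2 φ 0) (hmin : IsLocalMin φ 0)
    (hline : ∀ y, y ≠ 0 → 0 < iteratedDeriv 2 (fun t : ℝ => φ (t • y)) 0) :
    ∃ c : ℝ, 0 < c ∧ ∀ᶠ y in 𝓝 (0 : V), c * ‖y‖ ^ 2 ≤ φ y - φ 0 := by
  have hline' : ∀ y, y ≠ 0 → 0 < iteratedDeriv 2 (fun t : ℝ => φ (0 + t • y)) 0 := fun y hy => by
    simpa only [zero_add] using hline y hy
  simpa only [sub_zero] using quadratic_growth_of_contDiffAt_of_isLocalMin_of_line hφ hmin hline'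

/-- ★★ **GROWTH ⟹ HESS∘** (the converse, for the door): `φ` `C²` at `0` with the growth row ⟹ `0 < D²φ(0) y y` for `y ≠ 0` (from the growth and the Peano
expansion along the ray `t y`: `c t²‖y‖² ≤ ½ t² D²φ(0) y y + o(t²)`). [cite: Breitung1994, Thm 41 p.56; Balaban1985Variational, (142) p.299] -/
theorem hessian_pos_of_growthRow {φ : V → ℝ} (hφ : ContDiffAt ℝ 2 φ 0) {c : ℝ} (hc : 0 < c)
    (hgrow : ∀ᶠ y in 𝓝 (0 : V), c * ‖y‖ ^ 2 ≤ φ y - φ 0) :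
    ∀ y, y ≠ 0 → 0 < fderiv ℝ (fderiv ℝ φ) 0 y y := by
  obtain ⟨hS1, hS2⟩ := hasFDerivAt_data_of_contDiffAt_two hφ
  set S'' : V →L[ℝ] V →L[ℝ] ℝ := fderiv ℝ (fderiv ℝ φ) 0 with hS''
  set A : V →ₗ[ℝ] V :=
    ((InnerProductSpace.continuousLinearMapOfBilin (𝕜 := ℝ) S'' : V →L[ℝ] V) : V →ₗ[ℝ] V) with hAdef
  have hAS' : ∀ y z, ⟪A y, z⟫_ℝ = S'' y z := fun y z => by
    rw [hAdef, ContinuousLinearMap.coe_coe, InnerProductSpace.continuousLinearMapOfBilin_apply]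
  have hcrit : fderiv ℝ φ 0 = 0 := (isLocalMin_of_quadratic_growth hc (by simpa only [sub_zero] using hgrow)).fderiv_eq_zero
  have hPeano : (fun y => φ y - φ 0 - (1 / 2) * ⟪A y, y⟫_ℝ) =o[𝓝 0] fun y => ‖y‖ ^ 2 := by
    have h := isLittleO_taylor_two hS1 hS2
    refine (h.congr' (Eventually.of_forall fun x => ?_) (Eventually.of_forall fun x => ?_))
    · simp only [hcrit, zero_apply, sub_zero, hAS']
    · simp only [sub_zero]
  intro y hy
  rw [← hAS']
  exact FluctuationComparisonRegPrIntLS2BetaLaplaceLimit.inner_pos_of_quadratic_growth hc hgrow hPeano y hy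

/-- ★★★ **THE TWO-WAY DOOR**: for `φ` `C²` at `0`, the tree's growth row ⟺ (`0` is a local minimum ∧ HESS∘ `∀ y ≠ 0, 0 < D²φ(0) y y`).
[cite: Breitung1994, Thm 41 p.56; Balaban1985Variational, (142) p.299] -/
theorem growthRow_iff_isLocalMin_and_hessian_pos {φ : V → ℝ} (hφ : ContDiffAt ℝ 2 φ 0) :
    (∃ c : ℝ, 0 < c ∧ ∀ᶠ y in 𝓝 (0 : V), c * ‖y‖ ^ 2 ≤ φ y - φ 0) ↔
      (IsLocalMin φ 0 ∧ ∀ y, y ≠ 0 → 0 < fderiv ℝ (fderiv ℝ φ) 0 y y) := by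
  constructor
  · rintro ⟨c, hc, hgrow⟩
    exact ⟨isLocalMin_of_quadratic_growth hc (by simpa only [sub_zero] using hgrow), hessian_pos_of_growthRow hφ hc hgrow⟩
  · rintro ⟨hmin, hH⟩
    exact growthRow_of_hessian_pos hφ hmin hH

/-- ★★ **HESS∘ ⟹ THE LIMIT DOOR'S THREE HESSIAN ROWS** directly (`hAs ∕ hpos ∕ hS2` of ✓`…S2BetaLaplaceLimit.laplaceLimit_corner`): ✓`hessianRows_of_contDiffAt_of_growth` ∘ §3.
[cite: Breitung1994, Thm 41 p.56 and Lemma 40 p.55; Balaban1985Variational, (142) p.299] -/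
theorem hessianRows_of_hessian_pos [CompleteSpace V] {φ : V → ℝ} (hφ : ContDiffAt ℝ 2 φ 0) (hmin : IsLocalMin φ 0)
    (hH : ∀ y, y ≠ 0 → 0 < fderiv ℝ (fderiv ℝ φ) 0 y y) :
    ∃ Ah : V →ₗ[ℝ] V, Ah.IsSymmetric ∧ (∀ y, y ≠ 0 → 0 < ⟪Ah y, y⟫_ℝ) ∧
      (fun y => φ y - φ 0 - (1 / 2) * ⟪Ah y, y⟫_ℝ) =o[𝓝 0] fun y => ‖y‖ ^ 2 := by
  obtain ⟨c, hc, hgrow⟩ := growthRow_of_hessian_pos hφ hmin hH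
  exact hessianRows_of_contDiffAt_of_growth hφ hc hgrow

end Summit.QuantumFields.YangMills.Theorems.FluctuationComparisonRegPrIntLS2BetaGrowthOfHessianPos

end
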